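/-
Copyright (c) 2026 the pub-hodgecm-mathlib formalisation cell (harness21).  Prover seat hodgecm-mathlib-K2Liu-p13 (g4), Track B «K2-LIT»,
#184♮ = hLiu418 = `stmt-HodgeConjecture-24832`; ROAD Φ (RULING «M-156n»), #41 TOP — the FUBINI step of the (β) census `CENSUS-Beta-EulerFace.K2Liu-p13-g4.md` (between (E6′) «away
purity as a flat family» and ★ (E3) `exists_eulerHead_intertwiningDelta`): the `T`-block `∫ f_s(placesEmbed_T(w p_∞ h_∞, (w p_v h_v)_v)) d(ν_∞ ⊗ ⊗_{v∈T} ν_v)` of a family whose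
`T`-slice is a finite sum of pure tensors SPLITS into `Σ_i (∫_{N_∞} A_i) · ∏_{v∈T} (∫_{N_v} b_{i,v})` — pure measure theory (Mathlib `integral_prod_mul`, `integral_fintype_prod_eq_prod`).
THEOREMS ONLY (no `def`, no `instance`, no named-fact hypothesis, no `sorry`).
-/
import Mathlib.MeasureTheory.Integral.Pi
import Mathlib.MeasureTheory.Integral.Prod
import Mathlib.Analysis.Complex.Basic
import HarnessLib

/-!
# Crux `HLiu418`, ROAD Φ, organ Φ8 (row G6): FUBINI FOR THE `T`-BLOCK OF THE BIG-CELL EULER HEAD — a flat sum of pure tensors integrates to a sum of products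

Cell `hodgecm-mathlib`, crux item hLiu418 = `stmt-HodgeConjecture-24832` (helper lane, count-neutral).  ★ (E3) `K2LiuBigCellEulerHead.exists_eulerHead_intertwiningDelta` writes the big cell
of the socket's standard family as `M(s)f_s(h) = (∫ Φ_s ∂(ν_∞.prod (Measure.pi ν))) · ∏'_{v∉T}(…)` with the `T`-block integrand `Φ_s(p) = f_s(placesEmbed_T((w_Δ)_∞ p.1 h_∞, ((w_Δ)_v (p.2 v) h_v)_v))`
on `N_Δ(L⁺⊗ℝ) × ∏_{v∈T} N_Δ(L⁺_v)`; (E6′) (K2Liu-p03) presents the `T`-slice as a finite sum of pure tensors `Σ_i A_{i,s} ⊗ ⊗_{v∈T} b_{i,v,s}` for ALL `s`.  This file is the measure-theoretic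
step in between, generic in the carriers:
* §1 **`integral_prod_pi_mul_prod`** — `∫ F(p.1)·∏_v G_v(p.2 v) d(μ.prod (Measure.pi ν)) = (∫ F dμ)·∏_v ∫ G_v dν_v` (no integrability needed: Mathlib's conventions agree on both sides);
* §2 **`integral_sum_prod_pi`** — the finite-sum version under integrability of every factor (`Integrable.mul_prod`, `Integrable.fintype_prod_dep`), and
  **`integral_eq_sum_of_pureTensor`** — for an integrand `Φ` EQUAL to such a sum (the (E6′) decomposition read at the translated arguments): `∫ Φ = Σ_i (∫ F_i)·∏_v (∫ G_{i,v})`.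
Consumers instantiate `F i a := A_{i,s}((w_Δ)_∞ a h_∞)`, `G i v y := b_{i,v,s}((w_Δ)_v y h_v)` — the archimedean block (E8, ★ `kFinite_continuation` lineage) and the local intertwining integrals
`M_v(s) b_{i,v,s}(h_v)` (★ A7-AllS0 after the (F-GK-4)-type transport), whose scalar letters are ★ p861991 ∕ ★ p862028 ∕ 📤 p862064.
Sources: [Tan1999, §3]; [KudlaRallis1994, §1]; [BorelJacquet1979, §4.1]; [CasselsFrohlichANT1967, Ch. XV §3.3].
HONEST LABEL.  Helper lemmas, count-neutral; `HC_CM` is proved only modulo the 7 printed citations (2 remaining named inputs: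
hLiu418 = `stmt-HodgeConjecture-24832`, h413 = `stmt-HodgeConjecture-24833`) until rung 0 closes.
-/

set_option autoImplicit false
-- the mandated namespace repeats the single-problem summit's segment (`HodgeConjecture.HodgeConjecture`)
set_option linter.dupNamespace false

noncomputable section

open MeasureTheory

namespace Summit.HodgeConjecture.HodgeConjecture.Cruxes.HLiu418.K2LiuBigCellTBlockFubini

variable {X : Type*} [MeasurableSpace X] {ι : Type*} [Fintype ι] {Y : ι → Type*} [∀ v, MeasurableSpace (Y v)]
  (μ : Measure X) [SFinite μ] (ν : ∀ v, Measure (Y v)) [∀ v, SigmaFinite (ν v)]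

/-! ## §1 One pure tensor -/

/-- **`∫ F(p.1)·∏_v G_v(p.2 v) d(μ ⊗ ⊗_v ν_v) = (∫ F dμ) · ∏_v ∫ G_v dν_v`** (Mathlib `integral_prod_mul` + `integral_fintype_prod_eq_prod`; unconditional).
[cite: CasselsFrohlichANT1967, Ch. XV §3.3] [cite: BorelJacquet1979, §4.1] -/
theorem integral_prod_pi_mul_prod (F : X → ℂ) (G : ∀ v, Y v → ℂ) :
    ∫ p, F p.1 * ∏ v, G v (p.2 v) ∂(μ.prod (Measure.pi ν)) = (∫ a, F a ∂μ) * ∏ v, ∫ y, G v y ∂(ν v) := by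
  rw [integral_prod_mul (μ := μ) (ν := Measure.pi ν) F (fun y : ∀ v, Y v => ∏ v, G v (y v)), integral_fintype_prod_eq_prod]

/-! ## §2 A finite sum of pure tensors -/

/-- **`∫ Σ_i F_i(p.1)·∏_v G_{i,v}(p.2 v) = Σ_i (∫ F_i)·∏_v (∫ G_{i,v})`** when every `F_i ∈ L¹(μ)` and `G_{i,v} ∈ L¹(ν_v)` (`integral_finsetSum`, `Integrable.mul_prod`,
`Integrable.fintype_prod_dep`, §1). [cite: Tan1999, §3] [cite: KudlaRallis1994, §1] -/
theorem integral_sum_prod_pi {κ : Type*} (I : Finset κ) (F : κ → X → ℂ) (G : κ → ∀ v, Y v → ℂ)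
    (hF : ∀ i ∈ I, Integrable (F i) μ) (hG : ∀ i ∈ I, ∀ v, Integrable (G i v) (ν v)) :
    ∫ p, (∑ i ∈ I, F i p.1 * ∏ v, G i v (p.2 v)) ∂(μ.prod (Measure.pi ν)) = ∑ i ∈ I, (∫ a, F i a ∂μ) * ∏ v, ∫ y, G i v y ∂(ν v) := by
  rw [integral_finsetSum _ (fun i hi => (hF i hi).mul_prod (Integrable.fintype_prod_dep (hG i hi)))]
  exact Finset.sum_congr rfl fun i _ => integral_prod_pi_mul_prod μ ν (F i) (G i)

/-- **THE `T`-BLOCK OF A FLAT PURE-TENSOR SUM**: if the integrand `Φ` IS `Σ_i F_i(p.1)·∏_v G_{i,v}(p.2 v)` pointwise (the (E6′) decomposition read at the translated arguments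
`(w_Δ)_∞ p_∞ h_∞`, `(w_Δ)_v p_v h_v`), then `∫ Φ d(μ ⊗ ⊗_v ν_v) = Σ_i (∫ F_i dμ)·∏_v ∫ G_{i,v} dν_v`. [cite: Tan1999, §3] [cite: KudlaRallis1994, §1] [cite: BorelJacquet1979, §4.1] -/
theorem integral_eq_sum_of_pureTensor {κ : Type*} (I : Finset κ) (F : κ → X → ℂ) (G : κ → ∀ v, Y v → ℂ)
    (hF : ∀ i ∈ I, Integrable (F i) μ) (hG : ∀ i ∈ I, ∀ v, Integrable (G i v) (ν v))
    (Φ : X × (∀ v, Y v) → ℂ) (hΦ : ∀ p, Φ p = ∑ i ∈ I, F i p.1 * ∏ v, G i v (p.2 v)) :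
    ∫ p, Φ p ∂(μ.prod (Measure.pi ν)) = ∑ i ∈ I, (∫ a, F i a ∂μ) * ∏ v, ∫ y, G i v y ∂(ν v) := by
  rw [show Φ = fun p => ∑ i ∈ I, F i p.1 * ∏ v, G i v (p.2 v) from funext hΦ]
  exact integral_sum_prod_pi μ ν I F G hF hG

/-- the same with the two factors of the `T`-block written as a product `B · R` of the block integral and a tail (e.g. ★ (E3)'s `∏'_{v∉T}`): `B·R = (Σ_i …)·R`.
[cite: Tan1999, §3] -/
theorem mul_eq_sum_mul_of_pureTensor {κ : Type*} (I : Finset κ) (F : κ → X → ℂ) (G : κ → ∀ v, Y v → ℂ)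
    (hF : ∀ i ∈ I, Integrable (F i) μ) (hG : ∀ i ∈ I, ∀ v, Integrable (G i v) (ν v))
    (Φ : X × (∀ v, Y v) → ℂ) (hΦ : ∀ p, Φ p = ∑ i ∈ I, F i p.1 * ∏ v, G i v (p.2 v)) (R : ℂ) :
    (∫ p, Φ p ∂(μ.prod (Measure.pi ν))) * R = (∑ i ∈ I, (∫ a, F i a ∂μ) * ∏ v, ∫ y, G i v y ∂(ν v)) * R := by
  rw [integral_eq_sum_of_pureTensor μ ν I F G hF hG Φ hΦ]

end Summit.HodgeConjecture.HodgeConjecture.Cruxes.HLiu418.K2LiuBigCellTBlockFubini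

end
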